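import Summits.RiemannHypothesis.RiemannHypothesis.Theorems.NymanBeurlingFractSqIntegral
import Summits.RiemannHypothesis.RiemannHypothesis.Theorems.NymanBeurlingMinimiser
import HarnessLib

/-!
# RiemannHypothesis / Nyman–Beurling — the right-hand side `b_k = (log(k+1) + 1 − γ)/(k+1)` of the normal equations
and the `N = 1` row of the DATA table EXACTLY: `d_1² = 1 − (1−γ)²/(log 2π − γ)` (RH-FREE)

Column LI/NB of the RH ladder, rung L-P(P2) «structure of the NB minimiser», PROOF-OF-DATA for cell `pub/rh-li`.
Every DATA lineage (R / A / C2, DATA.md §L) solves `G c = b` with `b_k = ⟨χ, ρ_{k+1}⟩ = (log(k+1) + 1 − γ)/(k+1)`;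
this file proves that closed form, and evaluates the first row of the table in closed form:

* `integral_Ioc_fract_one_div`: `∫_{(0,1]} {1/x} dx = 1 − γ` (de la Vallée Poussin; summed over the Farey cells);
* `nbRhs_eq`: **`b_k = (log(k+1) + 1 − γ)/(k+1)`** (dilation `x ↦ (k+1)x`, then `{1/u} = 1/u` on `(1, k+1]`);
* `nbMinimiser_one`, `nbDistSq_nbMinimiser_one`, `tailConst_nbMinimiser_one`: for `N = 1`,
  `c⋆ = (1−γ)/(log 2π − γ)`, **`d_1² = 1 − (1−γ)²/(log 2π − γ)`** (`= 0.858212051395510884…`, lineage R's certified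
  `N = 1` entry of HOME/data/nb_R_dN2_allN10000.tsv to all its 40 digits), `tailConst(c⋆_1) = c⋆`; a kernel-side STEP-0 row.

RH-FREE [rh-li-eng-3]: explicit integrals and `1 × 1` linear algebra; nothing here bears on the truth of RH.
-/

noncomputable section

-- D-0017: `Summit.<S>.<S>.…` is the designed namespace of a single-problem summit.
set_option linter.dupNamespace false

open MeasureTheory Set Finset Filter

namespace Summit.RiemannHypothesis.RiemannHypothesis.Theorems.NbTheory

open Literature.NumberTheory.LFunctions Literature.NumberTheory.LFunctions.BaezDuarteOnlyIf
open GramPosDef Minimiser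

namespace GramRhs

/-- `{1/x}` is integrable on `(0,1]`. -/
lemma integrableOn_fract_one_div : IntegrableOn (fun x : ℝ ↦ Int.fract (1 / x)) (Set.Ioc (0 : ℝ) 1) :=
  integrableOn_Ioc_of_bounded (measurable_fract.comp (by fun_prop : Measurable fun x : ℝ ↦ 1 / x)) (M := 1)
    fun x ↦ by rw [abs_of_nonneg (Int.fract_nonneg _)]; exact (Int.fract_lt_one _).le

/-- `{1/u}` is interval-integrable on any `[a, b]` (bounded measurable). -/
lemma intervalIntegrable_fract_one_div (a b : ℝ) :
    IntervalIntegrable (fun u : ℝ ↦ Int.fract (1 / u)) volume a b := by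
  rw [intervalIntegrable_iff]
  show IntegrableOn _ (Set.Ioc (min a b) (max a b)) _
  refine Measure.integrableOn_of_bounded (M := 1) measure_Ioc_lt_top.ne
    ((measurable_fract.comp (by fun_prop : Measurable fun x : ℝ ↦ 1 / x)).aestronglyMeasurable)
    (ae_of_all _ fun x ↦ ?_)
  rw [Real.norm_eq_abs, abs_of_nonneg (Int.fract_nonneg _)]
  exact (Int.fract_lt_one _).le

/-- `log 2π − γ > 0` (indeed `> 1`: `log 2π > log e = 1 > 2/3 > γ`). -/
lemma log_two_pi_sub_gamma_pos : 0 < Real.log (2 * Real.pi) - Real.eulerMascheroniConstant := by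
  have h1 : 1 < Real.log (2 * Real.pi) := by
    rw [← Real.log_exp 1]
    refine Real.log_lt_log (Real.exp_pos 1) ?_
    have he : Real.exp 1 < 3 := lt_trans Real.exp_one_lt_d9 (by norm_num)
    have hπ : 3 < Real.pi := Real.pi_gt_three
    linarith
  have h2 := Real.eulerMascheroniConstant_lt_two_thirds
  linarith

end GramRhs

open GramRhs

/-- **`∫_{(0,1]} {1/x} dx = 1 − γ`** (RH-FREE; de la Vallée Poussin). -/
theorem integral_Ioc_fract_one_div :
    ∫ x in Set.Ioc (0 : ℝ) 1, Int.fract (1 / x) = 1 - Real.eulerMascheroniConstant := by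
  have hint := integrableOn_fract_one_div
  rw [Ioc_eq_iUnion_nbI] at hint ⊢
  rw [integral_iUnion measurableSet_nbI pairwise_disjoint_nbI hint]
  simp_rw [integral_nbI_fract]
  exact hasSum_nbTerm.tsum_eq

/-- `b_0 = ⟨χ, ρ_1⟩ = 1 − γ`. -/
theorem nbRhs_zero : nbRhs 0 = 1 - Real.eulerMascheroniConstant := by
  rw [← integral_Ioc_fract_one_div, nbRhs]
  refine setIntegral_congr_fun measurableSet_Ioc fun x _ ↦ ?_
  simp [nbRho]

/-- **The right-hand side of the normal equations (RH-FREE): `b_k = ⟨χ, ρ_{k+1}⟩ = (log(k+1) + 1 − γ)/(k+1)`.** -/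
theorem nbRhs_eq (k : ℕ) :
    nbRhs k = (Real.log ((k : ℝ) + 1) + 1 - Real.eulerMascheroniConstant) / ((k : ℝ) + 1) := by
  have hk : (0 : ℝ) < (k : ℝ) + 1 := by positivity
  have hk1 : (1 : ℝ) ≤ (k : ℝ) + 1 := by linarith [(k.cast_nonneg : (0 : ℝ) ≤ k)]
  -- `b_k = ∫_0^1 {1/((k+1)x)} dx = (k+1)⁻¹ ∫_0^{k+1} {1/u} du`
  have h1 : nbRhs k = ((k : ℝ) + 1)⁻¹ * ∫ u in (0 : ℝ)..((k : ℝ) + 1), Int.fract (1 / u) := by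
    have hcomp := intervalIntegral.integral_comp_mul_left (a := 0) (b := 1) (fun u : ℝ ↦ Int.fract (1 / u)) hk.ne'
    simp only [mul_zero, mul_one, smul_eq_mul] at hcomp
    rw [nbRhs, ← intervalIntegral.integral_of_le zero_le_one, ← hcomp]
    rfl
  -- split at `u = 1`; on `(1, k+1]`, `{1/u} = 1/u`
  have h2 : ∫ u in (0 : ℝ)..((k : ℝ) + 1), Int.fract (1 / u) =
      (∫ u in (0 : ℝ)..1, Int.fract (1 / u)) + ∫ u in (1 : ℝ)..((k : ℝ) + 1), Int.fract (1 / u) :=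
    (intervalIntegral.integral_add_adjacent_intervals (intervalIntegrable_fract_one_div 0 1)
      (intervalIntegrable_fract_one_div 1 _)).symm
  have h3 : ∫ u in (1 : ℝ)..((k : ℝ) + 1), Int.fract (1 / u) = Real.log ((k : ℝ) + 1) := by
    rw [intervalIntegral.integral_of_le hk1]
    have hc : ∫ u in Set.Ioc (1 : ℝ) ((k : ℝ) + 1), Int.fract (1 / u) = ∫ u in Set.Ioc (1 : ℝ) ((k : ℝ) + 1), u⁻¹ := by
      refine setIntegral_congr_fun measurableSet_Ioc fun u hu ↦ ?_
      have hu0 : 0 < u := zero_lt_one.trans hu.1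
      rw [Int.fract_eq_self.2 ⟨by positivity, by rw [div_lt_one hu0]; exact hu.1⟩, one_div]
    rw [hc, ← intervalIntegral.integral_of_le hk1, integral_inv_of_pos zero_lt_one hk, div_one]
  rw [h1, h2, h3, intervalIntegral.integral_of_le zero_le_one, integral_Ioc_fract_one_div]
  field_simp
  ring

/-! ## The `N = 1` row of the DATA table, exactly -/

/-- **`N = 1`: the minimiser is `c⋆ = (1 − γ)/(log 2π − γ)`** (`G_{11} c = b_1`). -/
theorem nbMinimiser_one :
    nbMinimiser 1 = fun _ ↦ (1 - Real.eulerMascheroniConstant) / (Real.log (2 * Real.pi) - Real.eulerMascheroniConstant) := by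
  symm
  refine eq_nbMinimiser_of_normalEq fun k ↦ ?_
  have hk : k = 0 := Subsingleton.elim _ _
  subst hk
  rw [Fin.sum_univ_one]
  show nbGram 0 0 * _ = nbRhs 0
  rw [nbGram_zero_zero, nbRhs_zero]
  field_simp [log_two_pi_sub_gamma_pos.ne']

/-- **`N = 1`: `d_1² = 1 − (1−γ)²/(log 2π − γ)`** (`= 0.858212051395510884…`; lineage R's certified first row). -/
theorem nbDistSq_nbMinimiser_one :
    nbDistSq 1 (nbMinimiser 1) =
      1 - (1 - Real.eulerMascheroniConstant) ^ 2 / (Real.log (2 * Real.pi) - Real.eulerMascheroniConstant) := by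
  rw [nbDistSq_nbMinimiser, Fin.sum_univ_one, nbMinimiser_one]
  show 1 - _ * nbRhs 0 = _
  rw [nbRhs_zero]
  ring

/-- **`N = 1`: `tailConst(c⋆_1) = c⋆ = (1 − γ)/(log 2π − γ)`** (so `κ_1 = (1−γ)/((log 2π − γ) − (1−γ)²) = 0.39077…`). -/
theorem tailConst_nbMinimiser_one :
    tailConst (nbMinimiser 1) = (1 - Real.eulerMascheroniConstant) / (Real.log (2 * Real.pi) - Real.eulerMascheroniConstant) := by
  rw [tailConst, Fin.sum_univ_one, nbMinimiser_one]
  simp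

end Summit.RiemannHypothesis.RiemannHypothesis.Theorems.NbTheory

end
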